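import Literature.AlgebraicGeometry.Resolution.ExceptionalCurveDegree
import Literature.AlgebraicGeometry.Resolution.PrimeDivisorIdeals
import Literature.AlgebraicGeometry.Motives.CartierDivisorOfIdealSheaf
import HarnessLib

/-!
# Negative definiteness of the exceptional intersection matrix, and codimension of closed points of a
# desingularization: Lipman 1969, §14 (Lemma (14.1) and the remark preceding it)

Topic: `Literature/AlgebraicGeometry/Resolution`. NAMED FACTS (D-0014), typed from the printed page of
J. Lipman, *Rational singularities, with applications to algebraic surfaces and unique factorization*,
Publ. Math. IHÉS 36 (1969) 195–279, §14 "Definition of the sequence", p. 224 (held copy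
`paper:doi-10-1007-bf02684604`, PDF p. 31): "As before, let `R` be a two-dimensional normal local ring, with maximal
ideal `𝔪`, admitting a desingularization `f : X → Spec(R)`. Note that every closed point on `X` is of codimension two
(by Zariski's "main theorem" [EGA III, (4.4.8)], for example). … Let `E_1, E_2, …, E_n` be the distinct components of the
closed fibre, i.e. all the integral curves on `X` with exceptional support … Lemma (14.1). — The intersection matrix
`((E_i·E_j))` is negative-definite." (du Val's lemma.)

Vocabulary (tree): `IsResolution` (`Resolution/ResolutionOfSingularities`), the integral exceptional curves
`excCurvePoints π` and the intersection number `excCurveDegree π D η = (𝒪_X(D)·E_η)` (`Resolution/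
Lipman1969RationalSurfaceSingularities`, §12), the prime divisor `[E_η] = ofIsEffectiveCartier (primeDivisorIdeal η)`
(`Motives/CartierDivisorOfIdealSheaf`, `Resolution/PrimeDivisorIdeals`); `(E_j·E_i) := excCurveDegree π [E_j] η_i`
(symmetric for `i ≠ j` by (13.1) d), `Lipman1969IntersectionTheory`).

* `Lipman1969_14_1` — for every finite set `F` of integral exceptional curves and every non-zero integer vector `y` on `F`:
  `Σ_i Σ_j y_i y_j (E_j·E_i) < 0` (stated for sub-configurations as well: a principal submatrix of a negative definite
  matrix is negative definite);
* `Lipman1969_14_closedPoint` — every closed point `x` of `X` has `coheight x = 2` (codimension two; Mathlib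
  `ringKrullDim_stalk_eq_coheight`).

Requested by the crux chain W4.4b of cell res-hironaka (rung `PersistenceSurface`, the pointed-cycle ceiling
`ca³(T) ⊆ I(Z⁽ᵗ⁾ − A⁽ᵗ⁾)`: binders `hneg` and «codimension-`≤ 1` points of the closed fibre are exceptional curves»).

## References
* J. Lipman, Publ. Math. IHÉS 36 (1969), §14, p. 224: remark on closed points, Lemma (14.1). [Lipman1969]
* A. Grothendieck, EGA III, (4.4.8) (Zariski's main theorem, the codimension remark). [EGAIII]
* P. Du Val (the lemma's attribution in Lipman); D. Mumford, Publ. Math. IHÉS 9 (1961) (negative definiteness).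
-/

noncomputable section

open CategoryTheory AlgebraicGeometry TopologicalSpace IsLocalRing Order
open Literature.AlgebraicGeometry.Motives

universe u

namespace Literature.AlgebraicGeometry.Resolution

/-- NAMED FACT — **Lipman 1969, Lemma (14.1)** (du Val): "Let `R` be a two-dimensional normal local ring … admitting a
desingularization `f : X → Spec(R)` … Let `E_1, …, E_n` be the distinct components of the closed fibre … Lemma (14.1). —
The intersection matrix `((E_i·E_j))` is negative-definite." Rendered for `S` a Noetherian normal local domain of Krull
dimension `2`, `π : X → Spec S` a resolution (`X` integral, locally Noetherian), a finite set `F ⊆ excCurvePoints π` with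
invertibility witnesses `hc` for the prime divisors `[E_η]`, and `(E_j·E_i) := excCurveDegree π [E_j] η_i`: for every
non-zero `y : F → ℤ`, `Σ_i Σ_j y_i y_j (E_j·E_i) < 0`. Users take `(h : Lipman1969_14_1)`.
[cite: Lipman1969, Lemma (14.1) (p. 224)] -/
def Lipman1969_14_1 : Prop :=
  ∀ (S : Type u) [CommRing S] [IsNoetherianRing S] [IsLocalRing S] [IsDomain S] [IsIntegrallyClosed S],
    ringKrullDim S = 2 →
    ∀ (X : Scheme.{u}) [IsIntegral X] [IsLocallyNoetherian X] (π : X ⟶ Spec (.of S)), IsResolution π →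
    ∀ (F : Finset X), (∀ η ∈ F, η ∈ excCurvePoints π) →
    ∀ (hc : ∀ η ∈ F, IsEffectiveCartier (primeDivisorIdeal η)) (y : {η // η ∈ F} → ℤ), y ≠ 0 →
      ∑ i, ∑ j, y i * y j *
        excCurveDegree π (CartierDivisor.ofIsEffectiveCartier (primeDivisorIdeal (j : X)) (hc j j.2)) i < 0
-- TODO(general form): Lipman proves (14.1) for any two-dimensional normal local ring admitting a desingularization
-- (excellence/Noetherian hypotheses as in §1); the matrix is indexed by ALL components — sub-configurations follow.

/-- NAMED FACT — **Lipman 1969, §14 (p. 224), codimension of closed points**: "As before, let `R` be a two-dimensional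
normal local ring … admitting a desingularization `f : X → Spec(R)`. Note that every closed point on `X` is of
codimension two (by Zariski's "main theorem" [EGA III, (4.4.8)], for example)." Rendered for `S` a Noetherian normal local
domain of Krull dimension `2` and a resolution `π : X → Spec S` (`X` integral, locally Noetherian): every `x ∈ X` with
`{x}` closed has `coheight x = 2`. Users take `(h : Lipman1969_14_closedPoint)`. [cite: Lipman1969, Section 14 (p. 224)] -/
def Lipman1969_14_closedPoint : Prop :=
  ∀ (S : Type u) [CommRing S] [IsNoetherianRing S] [IsLocalRing S] [IsDomain S] [IsIntegrallyClosed S],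
    ringKrullDim S = 2 →
    ∀ (X : Scheme.{u}) [IsIntegral X] [IsLocallyNoetherian X] (π : X ⟶ Spec (.of S)), IsResolution π →
    ∀ x : X, IsClosed ({x} : Set X) → coheight x = 2

end Literature.AlgebraicGeometry.Resolution

end
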